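import Literature.NumberTheory.Automorphic.SatakeParametersGL
import HarnessLib

/-!
# `ℂ[e_1, …, e_n][e_n⁻¹] ≅ ℂ[ℤⁿ]^{S_n}`: proof of `symmLaurent_equiv_weylInvariants`

Discharge of the named fact `symmLaurent_equiv_weylInvariants` of module `SatakeParametersGL`
(Cartier, *Representations of p-adic groups: a survey*, Corvallis 1979, §IV.2, Example: for
`G = GL_n` the algebra `ℂ[X_*(T)]^W` is the algebra of symmetric Laurent polynomials
`ℂ[x_1^{±1}, …, x_n^{±1}]^{S_n} = ℂ[e_1, …, e_n, e_n⁻¹]`).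

## The argument (pure commutative algebra)

Let `P = ℂ[x_1, …, x_n] = MvPolynomial (Fin n) ℂ`, `L = ℂ[ℤⁿ] = AddMonoidAlgebra ℂ (Fin n → ℤ)`
(Laurent polynomials) and `ι : P → L` the embedding along `(Fin n →₀ ℕ) →+ (Fin n → ℤ)`
(`toLaurent`).  Then `ι` is injective, `S_n`-equivariant (`toLaurent_rename`) and
`ι(e_n) = ι(x_1 ⋯ x_n) = [𝟙]` is a unit of `L` with inverse `[-𝟙]`, both `S_n`-invariant.  Hence
`ι` induces, by the universal property of the localisation `symmLaurent n = P^{S_n}[1/e_n]`, an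
algebra map `Φ : P^{S_n}[1/e_n] → L^{S_n}` (`lift`).  `Φ` is injective because `ι` is
(`IsLocalization.lift_injective_iff`), and surjective because for `f ∈ L^{S_n}` and `k` larger
than all the pole orders of `f`, `[k𝟙] · f = ι(p)` has non-negative exponents, `p` is symmetric
by injectivity and equivariance of `ι`, and `f = Φ(p / e_n^k)`.

## Contents

* `SymmLaurent.expCast`, `SymmLaurent.toLaurent`: the embedding `ℂ[x] → ℂ[ℤⁿ]` and its API.
* `SymmLaurent.mem_weylInvariants_gl_iff`: invariance under `glWeylGroup n = S_n` is invariance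
  under the coordinate permutations.
* `SymmLaurent.lift`, `SymmLaurent.equiv`: the isomorphism, and the discharge
  `symmLaurent_equiv_weylInvariants_holds`.

Not here: the Satake isomorphism `ℋ(GL_n(F), GL_n(𝒪_F)) ≅ ℂ[e_1, …, e_n][e_n⁻¹]` itself
(`SatakeParametersGL.satake_gl`, a separate named fact of module `SatakeParametersGL`).

## References

* P. Cartier, *Representations of p-adic groups: a survey*, Corvallis 1979, part 1, §IV.2.
* B. Gross, *On the Satake isomorphism* (1998), §3.
-/

namespace Literature.NumberTheory.Automorphic

open MvPolynomial AddMonoidAlgebra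

namespace SymmLaurent

variable (n : ℕ)

/-! ### The embedding of polynomials into Laurent polynomials -/

/-- The exponent map `(Fin n →₀ ℕ) →+ (Fin n → ℤ)`, `d ↦ (i ↦ d i)`. [folklore] -/
def expCast : (Fin n →₀ ℕ) →+ (Fin n → ℤ) where
  toFun d i := (d i : ℤ)
  map_zero' := by funext i; simp
  map_add' d e := by funext i; simp

/-- Pointwise formula for `expCast`. [folklore] -/
@[simp]
theorem expCast_apply (d : Fin n →₀ ℕ) (i : Fin n) : expCast n d i = (d i : ℤ) := rfl

/-- `expCast` is injective. [folklore] -/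
theorem expCast_injective : Function.Injective (expCast n) := by
  intro d e h
  ext i
  have := congr_fun h i
  simpa using this

/-- A non-negative exponent vector is in the range of `expCast`. [folklore] -/
theorem mem_range_expCast {x : Fin n → ℤ} (hx : 0 ≤ x) : x ∈ Set.range (expCast n) := by
  refine ⟨Finsupp.equivFunOnFinite.symm fun i => (x i).toNat, ?_⟩
  funext i
  simp [Int.toNat_of_nonneg (hx i)]

/-- The embedding `ι : ℂ[x_1, …, x_n] → ℂ[ℤⁿ] = ℂ[x_1^{±1}, …, x_n^{±1}]` of polynomials into
Laurent polynomials, `x^d ↦ [d]`. [folklore] -/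
noncomputable def toLaurent : MvPolynomial (Fin n) ℂ →ₐ[ℂ] AddMonoidAlgebra ℂ (Fin n → ℤ) :=
  AddMonoidAlgebra.mapDomainAlgHom ℂ ℂ (expCast n)

/-- `toLaurent` is `mapDomain` along `expCast`. [folklore] -/
theorem toLaurent_apply (p : MvPolynomial (Fin n) ℂ) :
    toLaurent n p = AddMonoidAlgebra.mapDomain (expCast n) p := rfl

/-- `toLaurent` on monomials. [folklore] -/
@[simp]
theorem toLaurent_monomial (d : Fin n →₀ ℕ) (c : ℂ) :
    toLaurent n (monomial d c) = single (expCast n d) c := by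
  rw [toLaurent_apply, ← single_eq_monomial, AddMonoidAlgebra.mapDomain_single]

/-- `toLaurent` is injective. [folklore] -/
theorem toLaurent_injective : Function.Injective (toLaurent n) :=
  AddMonoidAlgebra.mapDomain_injective (expCast_injective n)

/-- A Laurent polynomial with non-negative exponents is a polynomial. [folklore] -/
theorem exists_toLaurent_eq {f : AddMonoidAlgebra ℂ (Fin n → ℤ)}
    (hf : ∀ x ∈ f.coeff.support, 0 ≤ x) : ∃ p, toLaurent n p = f :=
  ⟨AddMonoidAlgebra.comapDomain (expCast n) (expCast_injective n) f,
    AddMonoidAlgebra.mapDomain_comapDomain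
      (fun x hx => mem_range_expCast n (hf x (by simpa using hx))) _⟩

/-! ### Equivariance under `S_n` -/

/-- The coordinate permutation `funCongrLeft σ` acts by `x ↦ x ∘ σ`. [folklore] -/
theorem funCongrLeft_toAddEquiv_apply (σ : Equiv.Perm (Fin n)) (x : Fin n → ℤ) :
    (LinearEquiv.funCongrLeft ℤ ℤ σ).toAddEquiv x = x ∘ σ := rfl

/-- `expCast` intertwines `Finsupp.mapDomain σ` with precomposition by `σ⁻¹`. [folklore] -/
theorem expCast_mapDomain_perm (σ : Equiv.Perm (Fin n)) (d : Fin n →₀ ℕ) :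
    expCast n (Finsupp.mapDomain σ d) = expCast n d ∘ σ.symm := by
  funext j
  simp [Finsupp.mapDomain_equiv_apply]

/-- **Equivariance** of `toLaurent`: renaming the variables by `σ` corresponds to the domain
congruence along `x ↦ x ∘ σ⁻¹` of `ℂ[ℤⁿ]`. [folklore] -/
theorem toLaurent_rename (σ : Equiv.Perm (Fin n)) (p : MvPolynomial (Fin n) ℂ) :
    toLaurent n (rename σ p) =
      AddMonoidAlgebra.domCongr ℂ ℂ (LinearEquiv.funCongrLeft ℤ ℤ σ.symm).toAddEquiv
        (toLaurent n p) := by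
  refine MvPolynomial.induction_on' p (fun d c => ?_) (fun p q hp hq => ?_)
  · rw [rename_monomial, toLaurent_monomial, toLaurent_monomial, AddMonoidAlgebra.domCongr_single,
      funCongrLeft_toAddEquiv_apply, expCast_mapDomain_perm]
  · simp only [map_add, hp, hq]

/-- The image of a symmetric polynomial is invariant under the coordinate permutations.
[folklore] -/
theorem domCongr_toLaurent_of_isSymmetric {p : MvPolynomial (Fin n) ℂ} (hp : p.IsSymmetric)
    (σ : Equiv.Perm (Fin n)) :
    AddMonoidAlgebra.domCongr ℂ ℂ (LinearEquiv.funCongrLeft ℤ ℤ σ).toAddEquiv (toLaurent n p) =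
      toLaurent n p := by
  have h := toLaurent_rename n σ.symm p
  rw [hp σ.symm, Equiv.symm_symm] at h
  exact h.symm

/-- `domCongr e f = f` iff the coefficients of `f` are `e`-invariant. [folklore] -/
theorem domCongr_eq_self_iff {X : Type*} [AddCommMonoid X] (e : X ≃+ X)
    (f : AddMonoidAlgebra ℂ X) :
    AddMonoidAlgebra.domCongr ℂ ℂ e f = f ↔ ∀ x, f.coeff (e x) = f.coeff x := by
  constructor
  · intro h x
    have hx := congrArg (fun g : AddMonoidAlgebra ℂ X => g.coeff (e x)) h
    simp only [AddMonoidAlgebra.coeff_domCongr, AddEquiv.symm_apply_apply] at hx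
    exact hx.symm
  · intro h
    ext y
    rw [AddMonoidAlgebra.coeff_domCongr]
    simpa using (h (e.symm y)).symm

/-- `domCongr` along a lattice automorphism `w` fixes `f` iff the coefficients of `f` are
`w`-invariant. [folklore] -/
theorem domCongr_toAddEquiv_eq_self_iff {X : Type*} [AddCommGroup X] (w : X ≃ₗ[ℤ] X)
    (f : AddMonoidAlgebra ℂ X) :
    AddMonoidAlgebra.domCongr ℂ ℂ w.toAddEquiv f = f ↔ ∀ x, f.coeff (w x) = f.coeff x := by
  rw [domCongr_eq_self_iff]
  rfl

/-- Membership in `ℂ[ℤⁿ]^{S_n}` (`weylInvariants` for `glWeylGroup n`, the subgroup generated by the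
coordinate permutations) is invariance under every coordinate permutation. [folklore] -/
theorem mem_weylInvariants_gl_iff (f : AddMonoidAlgebra ℂ (Fin n → ℤ)) :
    f ∈ weylInvariants ℂ (Fin n → ℤ) (ConnectedReductiveGroupData.glWeylGroup n) ↔
      ∀ σ : Equiv.Perm (Fin n),
        AddMonoidAlgebra.domCongr ℂ ℂ (LinearEquiv.funCongrLeft ℤ ℤ σ).toAddEquiv f = f := by
  rw [mem_weylInvariants_iff]
  constructor
  · intro h σ
    exact h _ (Subgroup.subset_closure ⟨σ, rfl⟩)
  · intro h w hw
    unfold ConnectedReductiveGroupData.glWeylGroup at hw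
    induction hw using Subgroup.closure_induction with
    | mem w hw =>
      obtain ⟨σ, rfl⟩ := hw
      exact h σ
    | one =>
      rw [domCongr_toAddEquiv_eq_self_iff]
      intro x
      simp
    | mul a b _ _ ha hb =>
      rw [domCongr_toAddEquiv_eq_self_iff] at ha hb ⊢
      intro x
      rw [LinearEquiv.mul_apply, ha, hb]
    | inv a _ ha =>
      rw [domCongr_toAddEquiv_eq_self_iff] at ha ⊢
      intro x
      have hx := ha (a.symm x)
      rw [LinearEquiv.apply_symm_apply] at hx
      rw [LinearEquiv.coe_inv]
      exact hx.symm

/-- The monomial `[c𝟙]` of a constant exponent vector is `S_n`-invariant. [folklore] -/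
theorem single_const_mem_weylInvariants (c : ℤ) (a : ℂ) :
    single (fun _ : Fin n => c) a ∈
      weylInvariants ℂ (Fin n → ℤ) (ConnectedReductiveGroupData.glWeylGroup n) := by
  rw [mem_weylInvariants_gl_iff]
  intro σ
  rw [AddMonoidAlgebra.domCongr_single]
  rfl

/-! ### The map on symmetric polynomials -/

/-- The image of a symmetric polynomial lies in `ℂ[ℤⁿ]^{S_n}`. [folklore] -/
theorem toLaurent_mem_weylInvariants (p : symmetricSubalgebra (Fin n) ℂ) :
    ((toLaurent n).comp (symmetricSubalgebra (Fin n) ℂ).val) p ∈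
      weylInvariants ℂ (Fin n → ℤ) (ConnectedReductiveGroupData.glWeylGroup n) := by
  rw [mem_weylInvariants_gl_iff]
  intro σ
  exact domCongr_toLaurent_of_isSymmetric n p.2 σ

/-- `ℂ[x_1, …, x_n]^{S_n} → ℂ[ℤⁿ]^{S_n}`, the corestriction of `toLaurent`. [folklore] -/
noncomputable def toInvariants :
    symmetricSubalgebra (Fin n) ℂ →ₐ[ℂ]
      weylInvariants ℂ (Fin n → ℤ) (ConnectedReductiveGroupData.glWeylGroup n) :=
  ((toLaurent n).comp (symmetricSubalgebra (Fin n) ℂ).val).codRestrict _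
    (toLaurent_mem_weylInvariants n)

/-- Underlying Laurent polynomial of `toInvariants p`. [folklore] -/
@[simp]
theorem coe_toInvariants (p : symmetricSubalgebra (Fin n) ℂ) :
    (toInvariants n p : AddMonoidAlgebra ℂ (Fin n → ℤ)) = toLaurent n p := rfl

/-- `toInvariants` is injective. [folklore] -/
theorem toInvariants_injective : Function.Injective (toInvariants n) := by
  intro p q h
  have h' := congrArg Subtype.val h
  simp only [coe_toInvariants] at h'
  exact Subtype.val_injective (toLaurent_injective n h')

/-! ### `e_n ↦ [𝟙]`, a unit -/

/-- `e_n(x_1, …, x_n) = x_1 ⋯ x_n` is the monomial of exponent `(1, …, 1)`. [folklore] -/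
theorem esymm_fin_self_eq_monomial :
    MvPolynomial.esymm (Fin n) ℂ n = monomial (∑ i : Fin n, Finsupp.single i 1) 1 := by
  rw [MvPolynomial.esymm_eq_sum_monomial]
  have h : Finset.powersetCard n (Finset.univ : Finset (Fin n)) = {Finset.univ} := by
    simpa using Finset.powersetCard_self (Finset.univ : Finset (Fin n))
  rw [h, Finset.sum_singleton]

/-- `expCast (∑ i, δ_i) = 𝟙`. [folklore] -/
theorem expCast_sum_single : expCast n (∑ i : Fin n, Finsupp.single i 1) = 1 := by
  funext j
  simp [Finsupp.finsetSum_apply, Finsupp.single_apply]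

/-- `ι(e_n) = [𝟙]`. [folklore] -/
theorem toLaurent_esymmTop :
    toLaurent n (esymmTop n : MvPolynomial (Fin n) ℂ) = single 1 1 := by
  rw [coe_esymmTop, esymm_fin_self_eq_monomial, toLaurent_monomial, expCast_sum_single]

/-- `[𝟙]^k = [k𝟙]` in `ℂ[ℤⁿ]`. [folklore] -/
theorem single_one_pow (k : ℕ) :
    (single (1 : Fin n → ℤ) (1 : ℂ)) ^ k = single (fun _ : Fin n => (k : ℤ)) 1 := by
  rw [AddMonoidAlgebra.single_pow, one_pow]
  congr 1
  funext i
  simp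

/-- `ι(e_n) = [𝟙]` as a unit of `ℂ[ℤⁿ]^{S_n}`, with inverse `[-𝟙]`. [folklore] -/
noncomputable def esymmUnit :
    (weylInvariants ℂ (Fin n → ℤ) (ConnectedReductiveGroupData.glWeylGroup n))ˣ where
  val := toInvariants n (esymmTop n)
  inv := ⟨single (fun _ : Fin n => (-1 : ℤ)) 1, single_const_mem_weylInvariants n (-1) 1⟩
  val_inv := by
    apply Subtype.ext
    change toLaurent n (esymmTop n : MvPolynomial (Fin n) ℂ) *
        single (fun _ : Fin n => (-1 : ℤ)) 1 = 1
    rw [toLaurent_esymmTop, AddMonoidAlgebra.single_mul_single, AddMonoidAlgebra.one_def, mul_one]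
    rfl
  inv_val := by
    apply Subtype.ext
    change single (fun _ : Fin n => (-1 : ℤ)) (1 : ℂ) *
        toLaurent n (esymmTop n : MvPolynomial (Fin n) ℂ) = 1
    rw [toLaurent_esymmTop, AddMonoidAlgebra.single_mul_single, AddMonoidAlgebra.one_def, mul_one]
    rfl

/-- `toInvariants (e_n)` is a unit. [folklore] -/
theorem isUnit_toInvariants_esymmTop : IsUnit (toInvariants n (esymmTop n)) :=
  ⟨esymmUnit n, rfl⟩

/-! ### The isomorphism -/

/-- `Φ : ℂ[e_1, …, e_n][e_n⁻¹] → ℂ[ℤⁿ]^{S_n}`, the extension of `toInvariants` to the localisation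
(universal property, `IsLocalization.Away.liftAlgHom`). [folklore] -/
noncomputable def lift :
    symmLaurent n →ₐ[ℂ] weylInvariants ℂ (Fin n → ℤ) (ConnectedReductiveGroupData.glWeylGroup n) :=
  IsLocalization.Away.liftAlgHom (S := symmLaurent n) (esymmTop n) (f := toInvariants n)
    (isUnit_toInvariants_esymmTop n)

/-- `Φ` as a function is `IsLocalization.lift`. [folklore] -/
theorem coe_lift :
    ⇑(lift n) = IsLocalization.Away.lift (S := symmLaurent n) (esymmTop n)
      (g := (toInvariants n : symmetricSubalgebra (Fin n) ℂ →+*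
        weylInvariants ℂ (Fin n → ℤ) (ConnectedReductiveGroupData.glWeylGroup n)))
      (isUnit_toInvariants_esymmTop n) := rfl

/-- `Φ` is injective (because `ι` is). [folklore] -/
theorem lift_injective : Function.Injective (lift n) := by
  rw [coe_lift, IsLocalization.Away.lift, IsLocalization.lift_injective_iff]
  intro x y
  constructor
  · intro h
    have h' := congrArg (IsLocalization.Away.lift (S := symmLaurent n) (esymmTop n)
      (g := (toInvariants n : symmetricSubalgebra (Fin n) ℂ →+*
        weylInvariants ℂ (Fin n → ℤ) (ConnectedReductiveGroupData.glWeylGroup n)))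
      (isUnit_toInvariants_esymmTop n)) h
    simpa only [IsLocalization.Away.lift_eq] using h'
  · intro h
    rw [toInvariants_injective n h]

/-- A bound on the pole orders of a Laurent polynomial. [folklore] -/
theorem exists_bound (f : AddMonoidAlgebra ℂ (Fin n → ℤ)) :
    ∃ k : ℕ, ∀ x ∈ f.coeff.support, ∀ i, -(k : ℤ) ≤ x i := by
  refine ⟨f.coeff.support.sup fun x => Finset.univ.sup fun i => (x i).natAbs, ?_⟩
  intro x hx i
  have h1 : (x i).natAbs ≤ Finset.univ.sup fun j => (x j).natAbs :=
    Finset.le_sup (f := fun j => (x j).natAbs) (Finset.mem_univ i)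
  have h2 : (Finset.univ.sup fun j => (x j).natAbs) ≤
      f.coeff.support.sup fun y => Finset.univ.sup fun j => (y j).natAbs :=
    Finset.le_sup (f := fun y => Finset.univ.sup fun j => (y j).natAbs) hx
  have h3 : ((x i).natAbs : ℤ) ≤
      ((f.coeff.support.sup fun y => Finset.univ.sup fun j => (y j).natAbs : ℕ) : ℤ) := by
    exact_mod_cast h1.trans h2
  omega

/-- `Φ` is surjective: clear denominators by a power of `[𝟙] = ι(e_n)`. [folklore] -/
theorem lift_surjective : Function.Surjective (lift n) := by
  rw [coe_lift, IsLocalization.Away.lift, IsLocalization.lift_surjective_iff]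
  rintro ⟨f, hf⟩
  obtain ⟨k, hk⟩ := exists_bound n f
  set c : Fin n → ℤ := fun _ => (k : ℤ) with hc
  -- `[c] * f` has non-negative exponents, hence is a polynomial `p`
  have hg : ∀ y ∈ (single c (1 : ℂ) * f).coeff.support, 0 ≤ y := by
    intro y hy
    classical
    obtain ⟨x, hx, rfl⟩ := Finset.mem_image.1
      (AddMonoidAlgebra.support_coeff_single_mul_subset f 1 c hy)
    intro i
    have := hk x hx i
    simp only [hc, Pi.add_apply, Pi.zero_apply]
    omega
  obtain ⟨p, hp⟩ := exists_toLaurent_eq n hg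
  -- `p` is symmetric
  have hps : p.IsSymmetric := by
    intro σ
    apply toLaurent_injective n
    rw [toLaurent_rename, hp, map_mul, AddMonoidAlgebra.domCongr_single,
      (mem_weylInvariants_gl_iff n f).1 hf σ.symm]
    rfl
  refine ⟨(⟨p, hps⟩, ⟨esymmTop n ^ k, k, rfl⟩), ?_⟩
  apply Subtype.ext
  change f * toLaurent n ((esymmTop n : MvPolynomial (Fin n) ℂ) ^ k) = toLaurent n p
  rw [map_pow, toLaurent_esymmTop, single_one_pow, hp, mul_comm]

/-- **`ℂ[e_1, …, e_n][e_n⁻¹] ≅ ℂ[ℤⁿ]^{S_n}`** as `ℂ`-algebras (Cartier, Corvallis 1979, §IV.2,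
Example). [cite: CartierCorvallis1979, §IV.2 Example] -/
noncomputable def equiv :
    symmLaurent n ≃ₐ[ℂ] weylInvariants ℂ (Fin n → ℤ) (ConnectedReductiveGroupData.glWeylGroup n) :=
  AlgEquiv.ofBijective (lift n) ⟨lift_injective n, lift_surjective n⟩

end SymmLaurent

section Discharge

variable (n : ℕ)

/-- **Discharge of `symmLaurent_equiv_weylInvariants`** (for every `n`): the localised symmetric
polynomials `ℂ[e_1, …, e_n][e_n⁻¹]` are isomorphic, as a `ℂ`-algebra, to the `S_n`-invariants
`ℂ[ℤⁿ]^{S_n}` of the group algebra of the cocharacter lattice of the diagonal torus of `GL_n`;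
both are `ℂ[x_1^{±1}, …, x_n^{±1}]^{S_n} = ℂ[X_*(T)]^W` (Cartier, Corvallis 1979, §IV.2,
Example). [cite: CartierCorvallis1979, §IV.2 Example] -/
theorem symmLaurent_equiv_weylInvariants_holds : symmLaurent_equiv_weylInvariants n :=
  ⟨SymmLaurent.equiv n⟩

end Discharge

end Literature.NumberTheory.Automorphic
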